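import Mathlib
import Summits.ValiantsHypothesis.ValiantsHypothesis.Statement
import Summits.ValiantsHypothesis.ValiantsHypothesis.Theorems.SoloInformedQuadSpanWindow
import Summits.ValiantsHypothesis.ValiantsHypothesis.Theorems.SoloInformedUnivariatePolynomial
import Literature.Combinatorics.SimpleGraph.BondySimonovitsProofs
import HarnessLib

/-!
# Soloist (informed) rung: the sumset girth bound and the sparse-support case of (VB-poly)

Session s32 of the soloist programme `solo-ValiantsHypothesis-informed`.

The weakest certified-sufficient statement for `ValiantsHypothesis` on this line is the
univariate window bound `soloInformed_valiantsHypothesis_of_unipolyLogOrderBound`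
(file `SoloInformedUnivariatePolynomial.lean`): for some `γ < 3/2`, every family
`b : Fin s → ℂ[t]` and every set `E ⊂ ℕ` of exponents that is free of `±`-relations of order
`≤ ⌊log₂ s⌋ + 2` (`SoloNatFree`) with `t^e ∈ span_ℂ {b_i b_j}` for all `e ∈ E`
(`SoloUniPolyRealised`) has `|E| ≤ C s^γ`.

This file lands the ONE unconditional tool of the programme in that setting (the "sumset girth
bound", quadspan notes Lemma 3.3 / Remark 2.49), in kernel form:

* `soloInformed_sumsetGirth` — if `E ⊆ A + A` is free of `±1`-relations of support `≤ 2k`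
  (`SoloNatFree K h E` with `2k ≤ K`, `1 ≤ h`), then `|E| ≤ |A| + 86 k |A|^{1+1/k}`.
  Proof: one representation `e = a + a'` (`a ≠ a'`) is chosen for every non-double `e ∈ E`; this
  is a simple graph on `A` with one edge per such `e`; by the Bondy–Simonovits even-cycle theorem
  (`Literature.Combinatorics.SimpleGraph.BondySimonovits1974.evenCycle_of_manyEdges`, constant `86`) more than
  `86 k |A|^{1+1/k}` edges force a cycle `a_0 a_1 … a_{2k} = a_0` of length exactly `2k`, and the
  alternating sum `Σ (-1)^i (a_i + a_{i+1}) = 0` is a nontrivial `±1`-relation of support `2k`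
  among the (pairwise distinct) labels `a_i + a_{i+1} ∈ E` — contradicting freeness.
* `soloInformed_unipolyRealised_subset_sumset` — if every `b_j` is supported on `S ⊆ ℕ`, then every
  realised exponent set satisfies `E ⊆ S + S`.
* `soloInformed_unipoly_card_le_of_supportCover` — hence `|E| ≤ |S| + 86 k |S|^{1+1/k}`:
  the SPARSE-SUPPORT CASE of (VB-poly).  With `K = ⌊log₂ s⌋ + 2` and `|S| ≤ s^{O(1)}` the factor
  `|S|^{1/k}` is `O(1)`, so the hypothesis of `…_of_unipolyLogOrderBound` holds for every family
  whose total support `⋃ supp b_j` has at most `s^γ / (C' log s)` monomials (`γ < 3/2`); a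
  counterexample to (VB-poly-log) must therefore spread over `s^{3/2 - o(1)}` monomials
  (requirement (R1) of the quadspan census, now a theorem).

PATH TO THE SUMMIT: `…_of_supportCover` is (VB-poly) restricted to `|⋃ supp b_j| ≤ s^{3/2-o(1)}`;
(VB-poly) at order `⌊log₂ s⌋+2` is `hQ` of `soloInformed_valiantsHypothesis_of_unipolyLogOrderBound`,
which gives `ValiantsHypothesis`.  The complementary (dense-support) regime is the open core
(quadspan Remark 7.19, the `n → s` conversion); nothing here touches it.

References: J. A. Bondy, M. Simonovits, *Cycles of even length in graphs*, JCTB 16 (1974) 97–105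
(via the Literature file `BondySimonovitsProofs`); the soloist notes `paper/quadspan.md` §3
(Lemma 3.3, Corollary 3.4), §2.10 (Remark 2.49), `paper/sharpest.md` §9.11.
-/

namespace Summit.ValiantsHypothesis.ValiantsHypothesis.Theorems

open Finset
open scoped Pointwise

/-- Alternating telescoping: `Σ_{i<n} (-1)^i (x_i + x_{i+1}) = x_0 - (-1)^n x_n`. -/
theorem solo_alternating_telescope (x : ℕ → ℤ) (n : ℕ) :
    ∑ i ∈ range n, (-1 : ℤ) ^ i * (x i + x (i + 1)) = x 0 - (-1 : ℤ) ^ n * x n := by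
  induction n with
  | zero => simp
  | succ n ih => rw [sum_range_succ, ih, pow_succ]; ring

/-- **Sumset girth bound** (quadspan Lemma 3.3 / Remark 2.49, kernel form).
If `E ⊆ A + A` carries no nontrivial `±`-relation of support `≤ K` and height `≤ h`
(`SoloNatFree K h E`) with `2k ≤ K`, `1 ≤ k`, `1 ≤ h`, then
`|E| ≤ |A| + 86 k |A|^{1 + 1/k}`. -/
theorem soloInformed_sumsetGirth {K h k : ℕ} (hk : 1 ≤ k) (hK : 2 * k ≤ K) (hh : 1 ≤ h)
    (A E : Finset ℕ) (hEA : E ⊆ A + A) (hfree : SoloNatFree K h E) :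
    (E.card : ℝ) ≤ A.card + 86 * k * (A.card : ℝ) ^ (1 + 1 / (k : ℝ)) := by
  classical
  -- split off the doubles `2a`
  set D : Finset ℕ := A.image (fun a => 2 * a) with hD
  set E₁ : Finset ℕ := E \ D with hE₁
  have hsplit : (E.card : ℝ) = E₁.card + (E ∩ D).card := by
    have h := Finset.card_sdiff_add_card_inter E D
    have h' : E.card = E₁.card + (E ∩ D).card := by rw [hE₁]; omega
    exact_mod_cast h'
  have hD_le : ((E ∩ D).card : ℝ) ≤ A.card := by
    have h1 : (E ∩ D).card ≤ D.card := card_le_card inter_subset_right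
    have h2 : D.card ≤ A.card := card_image_le
    exact_mod_cast h1.trans h2
  suffices hmain : (E₁.card : ℝ) ≤ 86 * k * (A.card : ℝ) ^ (1 + 1 / (k : ℝ)) by linarith
  by_contra hlt
  have hlt := not_le.mp hlt
  -- one representation `e = a + a'`, `a ≠ a'`, for every `e ∈ E₁`
  have hrep : ∀ e ∈ E₁, ∃ ab : ℕ × ℕ, ab.1 ∈ A ∧ ab.2 ∈ A ∧ ab.1 ≠ ab.2 ∧ ab.1 + ab.2 = e := by
    intro e he
    rw [hE₁, mem_sdiff] at he
    obtain ⟨a, ha, b, hb, hab⟩ := Finset.mem_add.mp (hEA he.1)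
    refine ⟨(a, b), ha, hb, ?_, hab⟩
    intro h
    apply he.2
    rw [hD, mem_image]
    refine ⟨a, ha, ?_⟩
    simp only at h
    omega
  choose! rep hrep1 hrep2 hrepne hrepsum using hrep
  -- `N = |A| ≥ 1`
  set N := A.card with hN
  have hpos : (0 : ℝ) ≤ 86 * k * (N : ℝ) ^ (1 + 1 / (k : ℝ)) := by positivity
  have hN1 : 1 ≤ N := by
    by_contra h0
    have hA : A = ∅ := card_eq_zero.mp (by omega)
    have hE0 : E = ∅ := by
      rw [← subset_empty]
      intro e he
      have := hEA he
      rw [hA] at this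
      simp at this
    have : (E₁.card : ℝ) = 0 := by rw [hE₁, hE0]; simp
    linarith
  -- vertices `Fin N ≃ A`
  let φ : ↥A ≃ Fin N := A.equivFin
  let val : Fin N → ℕ := fun x => ((φ.symm x : ↥A) : ℕ)
  have hval_inj : Function.Injective val := by
    intro x y hxy
    exact φ.symm.injective (Subtype.ext hxy)
  let ι : ℕ → Fin N := fun a => if ha : a ∈ A then φ ⟨a, ha⟩ else ⟨0, hN1⟩
  have hval_ι : ∀ a ∈ A, val (ι a) = a := by
    intro a ha
    simp [val, ι, ha]
  -- the graph: one edge `{a, a'}` per `e ∈ E₁`, namely `rep e`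
  let G : SimpleGraph (Fin N) :=
    { Adj := fun x y => val x + val y ∈ E₁ ∧
        (rep (val x + val y) = (val x, val y) ∨ rep (val x + val y) = (val y, val x))
      symm := ⟨fun x y hxy => by
        refine ⟨by rw [add_comm]; exact hxy.1, ?_⟩
        rw [add_comm]
        exact hxy.2.symm⟩
      loopless := ⟨fun x hx => by
        have hne := hrepne _ hx.1
        rcases hx.2 with h2 | h2
        · exact hne (congrArg Prod.fst h2 ▸ congrArg Prod.snd h2 ▸ rfl)
        · exact hne ((congrArg Prod.fst h2).trans (congrArg Prod.snd h2).symm)⟩ }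
  -- `|E₁| ≤ e(G)`
  have hedge : (E₁.card : ℝ) ≤ (G.edgeSet.ncard : ℝ) := by
    let edgeOf : ℕ → Sym2 (Fin N) := fun e => s(ι (rep e).1, ι (rep e).2)
    have hmem : ∀ e ∈ E₁, edgeOf e ∈ G.edgeSet := by
      intro e he
      rw [SimpleGraph.mem_edgeSet]
      have h1 := hval_ι _ (hrep1 e he)
      have h2 := hval_ι _ (hrep2 e he)
      refine ⟨?_, Or.inl ?_⟩
      · rw [h1, h2, hrepsum e he]; exact he
      · rw [h1, h2, hrepsum e he]
    have key : ∀ e ∈ E₁, ∀ x y, edgeOf e = s(x, y) → val x + val y = e := by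
      intro e he x y hxy
      have h1 := hval_ι _ (hrep1 e he)
      have h2 := hval_ι _ (hrep2 e he)
      rcases Sym2.eq_iff.mp hxy with ⟨hx, hy⟩ | ⟨hx, hy⟩
      · rw [← hx, ← hy, h1, h2, hrepsum e he]
      · rw [← hx, ← hy, h2, h1, add_comm, hrepsum e he]
    have hinj : Set.InjOn edgeOf ↑E₁ := by
      intro e he e' he' hee'
      have := key e he (ι (rep e').1) (ι (rep e').2) hee'
      rw [hval_ι _ (hrep1 e' he'), hval_ι _ (hrep2 e' he'), hrepsum e' he'] at this
      exact this.symm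
    have hcard : (E₁.image edgeOf).card = E₁.card := card_image_of_injOn hinj
    have hsub : (↑(E₁.image edgeOf) : Set (Sym2 (Fin N))) ⊆ G.edgeSet := by
      intro z hz
      rw [Finset.coe_image] at hz
      obtain ⟨e, he, rfl⟩ := hz
      exact hmem e he
    have h := Set.ncard_le_ncard hsub G.edgeSet.toFinite
    rw [Set.ncard_coe_finset, hcard] at h
    exact_mod_cast h
  -- Bondy–Simonovits: a cycle of length exactly `2k`
  have hE' : (86 : ℝ) * k * (N : ℝ) ^ (1 + 1 / (k : ℝ)) < (G.edgeSet.ncard : ℝ) :=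
    lt_of_lt_of_le hlt hedge
  have hlk : (k : ℝ) ≤ k * (N : ℝ) ^ (1 / (k : ℝ)) := by
    have h1 : (1 : ℝ) ≤ (N : ℝ) ^ (1 / (k : ℝ)) :=
      Real.one_le_rpow (by exact_mod_cast hN1) (by positivity)
    have hk0 : (0 : ℝ) ≤ k := by positivity
    nlinarith
  obtain ⟨u, p, hcyc, hlen⟩ :=
    Literature.Combinatorics.SimpleGraph.BondySimonovits1974.evenCycle_of_manyEdges 86 (by norm_num) k N hk G hE'
      k le_rfl hlk
  have h3 : 3 ≤ p.length := hcyc.isCircuit.three_le_length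
  have hk2 : 2 ≤ k := by omega
  -- labels along the cycle
  let v : ℕ → Fin N := fun i => p.getVert i
  let lab : ℕ → ℕ := fun i => val (v i) + val (v (i + 1))
  have hadj : ∀ i < 2 * k, G.Adj (v i) (v (i + 1)) :=
    fun i hi => p.adj_getVert_succ (by rw [hlen]; exact hi)
  have hlabE₁ : ∀ i < 2 * k, lab i ∈ E₁ := fun i hi => (hadj i hi).1
  have hlabE : ∀ i < 2 * k, lab i ∈ E := fun i hi => (mem_sdiff.mp (hlabE₁ i hi)).1
  have hlabrep : ∀ i < 2 * k, rep (lab i) = (val (v i), val (v (i + 1))) ∨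
      rep (lab i) = (val (v (i + 1)), val (v i)) := fun i hi => (hadj i hi).2
  -- the labels are pairwise distinct (one edge per label, and a cycle repeats no edge)
  have hinj0 := hcyc.getVert_injOn'
  have hinj1 := hcyc.getVert_injOn
  have hdist : ∀ i < 2 * k, ∀ j < 2 * k, lab i = lab j → i = j := by
    intro i hi j hj hij
    have hpair : (v i = v j ∧ v (i + 1) = v (j + 1)) ∨ (v i = v (j + 1) ∧ v (i + 1) = v j) := by
      have ri := hlabrep i hi
      have rj := hlabrep j hj
      rw [hij] at ri
      rcases ri with ri | ri <;> rcases rj with rj | rj <;>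
        · have h := ri.symm.trans rj
          simp only [Prod.mk.injEq] at h
          first
            | exact Or.inl ⟨hval_inj h.1, hval_inj h.2⟩
            | exact Or.inr ⟨hval_inj h.1, hval_inj h.2⟩
            | exact Or.inr ⟨hval_inj h.2, hval_inj h.1⟩
            | exact Or.inl ⟨hval_inj h.2, hval_inj h.1⟩
    rcases hpair with ⟨h1, -⟩ | ⟨h1, h2⟩
    · exact hinj0 (by simp; omega) (by simp; omega) h1
    · exfalso
      by_cases hi0 : i = 0
      · subst hi0
        have hu : p.getVert (j + 1) = u := by
          show v (j + 1) = u
          rw [← h1]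
          exact p.getVert_zero
        have hj1 : j + 1 = 2 * k := by
          have := (hcyc.getVert_endpoint_iff (by rw [hlen]; omega)).mp hu
          omega
        have : (0 + 1 : ℕ) = j := hinj1 (by simp; omega) (by simp; omega) h2
        omega
      by_cases hj0 : j = 0
      · subst hj0
        have hu : p.getVert (i + 1) = u := by
          show v (i + 1) = u
          rw [h2]
          exact p.getVert_zero
        have hi1 : i + 1 = 2 * k := by
          have := (hcyc.getVert_endpoint_iff (by rw [hlen]; omega)).mp hu
          omega
        have : i = 0 + 1 := hinj1 (by simp; omega) (by simp; omega) h1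
        omega
      have e1 : i = j + 1 := hinj1 (by simp; omega) (by simp; omega) h1
      have e2 : i + 1 = j := hinj1 (by simp; omega) (by simp; omega) h2
      omega
  -- the alternating relation
  let c : ℕ → ℤ := fun e => ∑ i ∈ range (2 * k), if lab i = e then (-1 : ℤ) ^ i else 0
  have hc_lab : ∀ j < 2 * k, c (lab j) = (-1 : ℤ) ^ j := by
    intro j hj
    show (∑ i ∈ range (2 * k), if lab i = lab j then (-1 : ℤ) ^ i else 0) = (-1 : ℤ) ^ j
    rw [Finset.sum_eq_single j]
    · simp
    · intro i hi hij
      rw [if_neg]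
      intro h
      exact hij (hdist i (mem_range.mp hi) j hj h)
    · intro h
      exact absurd (mem_range.mpr hj) h
  have hc_zero : ∀ e, (∀ i < 2 * k, lab i ≠ e) → c e = 0 := by
    intro e he
    apply Finset.sum_eq_zero
    intro i hi
    rw [if_neg (he i (mem_range.mp hi))]
  have hsupp : (E.filter fun e => c e ≠ 0).card ≤ K := by
    have hsub : (E.filter fun e => c e ≠ 0) ⊆ (range (2 * k)).image lab := by
      intro e he
      rw [mem_filter] at he
      by_contra hne
      apply he.2
      apply hc_zero
      intro i hi h
      exact hne (mem_image.mpr ⟨i, mem_range.mpr hi, h⟩)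
    calc (E.filter fun e => c e ≠ 0).card ≤ ((range (2 * k)).image lab).card := card_le_card hsub
      _ ≤ (range (2 * k)).card := card_image_le
      _ = 2 * k := card_range _
      _ ≤ K := hK
  have hheight : ∀ e, |c e| ≤ h := by
    intro e
    by_cases hex : ∃ i < 2 * k, lab i = e
    · obtain ⟨i, hi, rfl⟩ := hex
      rw [hc_lab i hi]
      simp only [abs_pow, abs_neg, abs_one, one_pow]
      exact_mod_cast hh
    · have hex' : ∀ i < 2 * k, lab i ≠ e := fun i hi h => hex ⟨i, hi, h⟩
      rw [hc_zero e hex']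
      simp
  have hv : v (2 * k) = v 0 := by
    show p.getVert (2 * k) = p.getVert 0
    rw [← hlen, p.getVert_length, p.getVert_zero]
  have hsum : (∑ e ∈ E, c e * (e : ℤ)) = 0 := by
    calc (∑ e ∈ E, c e * (e : ℤ))
        = ∑ e ∈ E, ∑ i ∈ range (2 * k), (if lab i = e then (-1 : ℤ) ^ i else 0) * (e : ℤ) := by
          apply sum_congr rfl
          intro e _
          rw [Finset.sum_mul]
      _ = ∑ i ∈ range (2 * k), ∑ e ∈ E, (if lab i = e then (-1 : ℤ) ^ i else 0) * (e : ℤ) :=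
          Finset.sum_comm
      _ = ∑ i ∈ range (2 * k), (-1 : ℤ) ^ i * ((val (v i) : ℤ) + (val (v (i + 1)) : ℤ)) := by
          apply sum_congr rfl
          intro i hi
          rw [Finset.sum_eq_single (lab i)]
          · simp [lab]
          · intro e _ hne
            rw [if_neg (Ne.symm hne), zero_mul]
          · intro h
            exact absurd (hlabE i (mem_range.mp hi)) h
      _ = 0 := by
          rw [solo_alternating_telescope (fun i => (val (v i) : ℤ)) (2 * k)]
          simp only [hv, pow_mul, neg_one_sq, one_pow, one_mul, sub_self]
  -- contradiction with freeness
  have hall := hfree c hsupp hheight hsum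
  have h0 := hall (lab 0) (hlabE 0 (by omega))
  rw [hc_lab 0 (by omega)] at h0
  simp at h0

/-- Support of a product of polynomials lies in the sumset of the supports. -/
theorem solo_support_mul_subset_add {R : Type*} [Semiring R] (p q : Polynomial R) :
    (p * q).support ⊆ p.support + q.support := by
  intro n hn
  rw [Polynomial.mem_support_iff, Polynomial.coeff_mul] at hn
  obtain ⟨x, hx, hne⟩ := Finset.exists_ne_zero_of_sum_ne_zero hn
  have hx' : x.1 + x.2 = n := by simpa using hx
  have h1 : p.coeff x.1 ≠ 0 := fun h => hne (by rw [h, zero_mul])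
  have h2 : q.coeff x.2 ≠ 0 := fun h => hne (by rw [h, mul_zero])
  rw [← hx']
  exact Finset.add_mem_add (Polynomial.mem_support_iff.mpr h1) (Polynomial.mem_support_iff.mpr h2)

/-- Every element of the quadratic span of a family supported on `S` is supported on `S + S`. -/
theorem solo_support_subset_of_mem_quadSpan {s : ℕ} (S : Finset ℕ) (b : Fin s → Polynomial ℂ)
    (hb : ∀ j, (b j).support ⊆ S) (f : Polynomial ℂ)
    (hf : f ∈ Submodule.span ℂ (Set.range fun p : Fin s × Fin s => b p.1 * b p.2)) :
    f.support ⊆ S + S := by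
  classical
  induction hf using Submodule.span_induction with
  | mem x hx =>
      obtain ⟨p, rfl⟩ := hx
      exact (solo_support_mul_subset_add _ _).trans (Finset.add_subset_add (hb p.1) (hb p.2))
  | zero => simp
  | add x y _ _ hx hy => exact Polynomial.support_add.trans (Finset.union_subset hx hy)
  | smul a x _ hx => exact (Polynomial.support_smul a x).trans hx

/-- A realised exponent set lies in the sumset of the total support. -/
theorem soloInformed_unipolyRealised_subset_sumset {s : ℕ} (S : Finset ℕ)
    (b : Fin s → Polynomial ℂ) (hb : ∀ j, (b j).support ⊆ S) (E : Finset ℕ)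
    (hreal : SoloUniPolyRealised b E) : E ⊆ S + S := by
  classical
  intro e he
  have h := solo_support_subset_of_mem_quadSpan S b hb _ (hreal e he)
  rw [Polynomial.support_X_pow] at h
  exact h (Finset.mem_singleton_self e)

/-- **Sparse-support case of (VB-poly)** (kernel form).  If `b_1, …, b_s ∈ ℂ[t]` are all supported
on `S ⊆ ℕ`, then every `(K, h)`-free exponent set realised in `span_ℂ {b_i b_j}` has
`|E| ≤ |S| + 86 k |S|^{1+1/k}` whenever `2k ≤ K`, `1 ≤ k`, `1 ≤ h`.  In particular the hypothesis
`hQ` of `soloInformed_valiantsHypothesis_of_unipolyLogOrderBound` can only fail on families whose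
total support has `s^{3/2 - o(1)}` monomials. -/
theorem soloInformed_unipoly_card_le_of_supportCover {K h k s : ℕ} (hk : 1 ≤ k) (hK : 2 * k ≤ K)
    (hh : 1 ≤ h) (S : Finset ℕ) (b : Fin s → Polynomial ℂ) (hb : ∀ j, (b j).support ⊆ S)
    (E : Finset ℕ) (hfree : SoloNatFree K h E) (hreal : SoloUniPolyRealised b E) :
    (E.card : ℝ) ≤ S.card + 86 * k * (S.card : ℝ) ^ (1 + 1 / (k : ℝ)) := by
  classical
  exact soloInformed_sumsetGirth hk hK hh S E
    (soloInformed_unipolyRealised_subset_sumset S b hb E hreal) hfree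

end Summit.ValiantsHypothesis.ValiantsHypothesis.Theorems
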